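import Mathlib
import HarnessLib
import Summits.NavierStokesRegularity.NavierStokesRegularity.Theorems.LocalSineTubeDoorLocalPointZoomGradSlices
import Summits.NavierStokesRegularity.NavierStokesRegularity.Theorems.LocalSineTubeDoorLocalPointZoomDiag

/-!
# The SEQUENTIAL WINDOW ZOOM: convergence of the window velocities and gradients along ANY bounded-gap sequence of
# times, after a subsequence, to ONE slice of a Type-I profile

Cell ns-regularity-ideate, seat p6 (`--supports stmt-NavierStokesRegularity-20017`).  The frame-free content of the
sequential door `…SequentialDoor.sequentialDoor_of_oneSliceWindowRigidity`, packaged for reuse by every door template whose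
profile crux is ONE-SLICE (single-point scalars, two-point scalars such as the direction-free cross door, …):

* `sequentialWindowZoom` — local Type I at `(x₀,T)` + NOT backward bounded + a sequence `tₖ → T` in `[0,T)` with bounded gaps
  `T − tₖ₊₁ ≥ c (T − tₖ)` (`c > 0`) ⇒ there are a Type-I-class profile `v` (rate, continuity on the open slab, unit-viscosity
  Oseen–Duhamel identity, divergence-free slices) singular at the apex, a slice `s⋆ < 0`, a scale `σ∞ > 0` and a selection
  `k(j) → ∞` such that for EVERY `y` the window velocities `√(T−t_{k(j)}) u(t_{k(j)}, x₀ + √(T−t_{k(j)}) y)` converge to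
  `σ∞ν • v(s⋆, σ∞ y)` and the window gradients `(T−t_{k(j)}) ∇u(t_{k(j)})(x₀ + √(T−t_{k(j)}) y)` to `σ∞²ν • ∇v(s⋆)(σ∞ y)`.
  (Zoom frame; first-`k` selection `T − tₖ ∈ (cΛⱼ²/ν, Λⱼ²/ν]`; Bolzano–Weierstrass on the slice parameters; diagonal
  convergence `…LocalPointZoomDiag.localZoomFrame_diag` in the `√(−s⋆)`-rescaled subsequence frame.)

WHAT THIS IS NOT: not a claim about Navier–Stokes regularity; a compactness lemma for door routes (bears_on LADDER-NS N0).
-/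

noncomputable section

-- the summit and its single sub-problem share the name (CONVENTIONS §1), as in every Theorems file
set_option linter.dupNamespace false

namespace Summit.NavierStokesRegularity.NavierStokesRegularity.Theorems.LocalSineTubeDoorSequentialZoom

open MeasureTheory Set Function Filter Topology TopologicalSpace Metric
open scoped RealInnerProductSpace InnerProductSpace NNReal ENNReal
open Literature.Analysis Literature.Analysis.FluidPDE Literature.Analysis.FluidPDE.SereginSverak2009
open Summit.NavierStokesRegularity.NavierStokesRegularity.Theorems
open Summit.NavierStokesRegularity.NavierStokesRegularity.Theorems.LocalSineTubeDoorProfileAlignedWindowRigidityAncient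
open Summit.NavierStokesRegularity.NavierStokesRegularity.Theorems.LocalSineTubeDoorLocalPointZoomFrame
open Summit.NavierStokesRegularity.NavierStokesRegularity.Theorems.LocalSineTubeDoorLocalPointZoomSlices
open Summit.NavierStokesRegularity.NavierStokesRegularity.Theorems.LocalSineTubeDoorLocalPointZoomGradSlices
open Summit.NavierStokesRegularity.NavierStokesRegularity.Theorems.LocalSineTubeDoorLocalPointZoomDiag

/-- **THE SEQUENTIAL WINDOW ZOOM.**  See the module docstring. -/
theorem sequentialWindowZoom {ν T : ℝ} (hν : 0 < ν) (hT : 0 < T)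
    {u : ℝ → EuclideanSpace ℝ (Fin 3) → EuclideanSpace ℝ (Fin 3)} {p : ℝ → EuclideanSpace ℝ (Fin 3) → ℝ}
    (hsol : IsClassicalNSSolutionOn (Ico 0 T) ν 0 u p) (hLH : IsLerayHopfOn T ν 0 (u 0) u)
    {x₀ : EuclideanSpace ℝ (Fin 3)} {ρ M : ℝ} (hρ : 0 < ρ)
    (hM : ∀ t ∈ Ico 0 T, T - ρ ^ 2 < t → ∀ x ∈ ball x₀ ρ, ‖u t x‖ * Real.sqrt (ν * (T - t)) ≤ M)
    (hnotbd : ¬ IsBackwardBoundedAt u T x₀)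
    {t : ℕ → ℝ} {c : ℝ} (hc : 0 < c) (htk : ∀ k, t k ∈ Ico 0 T) (htT : Tendsto t atTop (𝓝 T))
    (hgap : ∀ k, c * (T - t k) ≤ T - t (k + 1)) :
    ∃ (C : ℝ) (v : ℝ → EuclideanSpace ℝ (Fin 3) → EuclideanSpace ℝ (Fin 3)) (sstar σinf : ℝ) (ksel : ℕ → ℕ),
      (HasTypeITimeDecay C v ∧ ContinuousOn (uncurry v) (Iio (0 : ℝ) ×ˢ univ) ∧
        (∀ s t : ℝ, s < t → t < 0 → ∀ x,
          v t x = UnboundedOperators.heatExtension (v s) (t - s) x - oseenDuhamel 1 s v v t x) ∧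
        (∀ t < 0, VectorCalculus.IsDivFree (v t))) ∧
      IsBackwardSingularPoint v 0 ∧ sstar < 0 ∧ 0 < σinf ∧ Tendsto ksel atTop atTop ∧
      ∀ y : EuclideanSpace ℝ (Fin 3),
        Tendsto (fun j => Real.sqrt (T - t (ksel j)) • u (t (ksel j)) (x₀ + Real.sqrt (T - t (ksel j)) • y)) atTop
          (𝓝 ((σinf * ν) • v sstar (σinf • y))) ∧
        Tendsto (fun j => Real.sqrt (T - t (ksel j)) ^ 2 •
            fderiv ℝ (u (t (ksel j))) (x₀ + Real.sqrt (T - t (ksel j)) • y)) atTop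
          (𝓝 ((σinf ^ 2 * ν) • fderiv ℝ (v sstar) (σinf • y))) := by
  obtain ⟨R, C₁, v', π', lam, w, v₁, Ks, r₁, hR, hlam, hlam0, hball1, hr₁, hr₁1, hKs, hL3, hae, hP,
    hsing₁, hpt⟩ := localTreeZoomFrame hν hT hsol hLH hρ hM hnotbd
  have hΛ : ∀ j, 0 < R * (lam j / 2) := fun j => mul_pos hR (half_pos (hlam j))
  set τ : ℕ → ℝ := fun j => (R * (lam j / 2)) ^ 2 / ν with hτdef
  have hτ : ∀ j, 0 < τ j := fun j => div_pos (pow_pos (hΛ j) 2) hν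
  have hτ0 : Tendsto τ atTop (𝓝 0) := by
    simpa using (((hlam0.div_const 2).const_mul R).pow 2).div_const ν
  have hgpos : ∀ k, 0 < T - t k := fun k => sub_pos.2 (htk k).2
  have hg0 : Tendsto (fun k => T - t k) atTop (𝓝 0) := by simpa using (tendsto_const_nhds (x := T)).sub htT
  have hsmall : ∀ {ε : ℝ}, 0 < ε → ∀ᶠ k in atTop, T - t k < ε := fun {ε} hε =>
    (Metric.tendsto_nhds.1 hg0 ε hε).mono fun k hk => by rwa [Real.dist_eq, sub_zero, abs_of_pos (hgpos k)] at hk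
  have hτsmall : ∀ {ε : ℝ}, 0 < ε → ∀ᶠ j in atTop, τ j < ε := fun {ε} hε =>
    (Metric.tendsto_nhds.1 hτ0 ε hε).mono fun j hj => by rwa [Real.dist_eq, sub_zero, abs_of_pos (hτ j)] at hj
  -- ## selection: the first `k` with `T − tₖ ≤ τⱼ`
  have hex : ∀ j, ∃ k, T - t k ≤ τ j := fun j => by
    obtain ⟨k, hk⟩ := (hsmall (hτ j)).exists
    exact ⟨k, hk.le⟩
  classical
  set kk : ℕ → ℕ := fun j => Nat.find (hex j) with hkkdef
  have hkk_le : ∀ j, T - t (kk j) ≤ τ j := fun j => Nat.find_spec (hex j)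
  have hkk_min : ∀ j k, k < kk j → τ j < T - t k := fun j k hk =>
    lt_of_not_ge (Nat.find_min (hex j) hk)
  have hsel : ∀ᶠ j in atTop, c * τ j < T - t (kk j) := by
    filter_upwards [hτsmall (hgpos 0)] with j hj
    have hk0 : kk j ≠ 0 := by
      intro h0
      have h1 := hkk_le j
      rw [h0] at h1
      linarith
    obtain ⟨m, hm⟩ := Nat.exists_eq_succ_of_ne_zero hk0
    have h1 : τ j < T - t m := hkk_min j m (by omega)
    calc c * τ j < c * (T - t m) := mul_lt_mul_of_pos_left h1 hc
      _ ≤ T - t (m + 1) := hgap m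
      _ = T - t (kk j) := by rw [hm]
  have hkk : Tendsto kk atTop atTop := by
    refine tendsto_atTop_atTop.2 fun K => ?_
    have hall : ∀ᶠ j in atTop, ∀ i : Fin K, τ j < T - t i :=
      eventually_all.2 fun i => hτsmall (hgpos i)
    obtain ⟨J, hJ⟩ := eventually_atTop.1 hall
    refine ⟨J, fun j hj => ?_⟩
    by_contra hlt
    push Not at hlt
    have h1 := hJ j hj ⟨kk j, hlt⟩
    exact absurd (hkk_le j) (not_le.2 h1)
  -- ## the slice parameters `sⱼ = −(T − t_{k(j)})/τⱼ ∈ [−1, −c]` (eventually) and a convergent subsequence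
  set sq : ℕ → ℝ := fun j => -(T - t (kk j)) / τ j with hsqdef
  have hsq_id : ∀ j, T - t (kk j) = τ j * (-sq j) := by
    intro j
    simp only [hsqdef]
    field_simp [(hτ j).ne']
  have hsq_mem : ∀ᶠ j in atTop, sq j ∈ Icc (-1 : ℝ) (-c) := by
    filter_upwards [hsel] with j hj
    refine ⟨?_, ?_⟩
    · simp only [hsqdef]
      rw [neg_div, neg_le_neg_iff, div_le_one (hτ j)]
      exact hkk_le j
    · simp only [hsqdef]
      rw [neg_div, neg_le_neg_iff, le_div_iff₀ (hτ j)]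
      exact hj.le
  obtain ⟨sstar, hsstar_mem, φ, hφ, hsφ⟩ := tendsto_subseq_of_frequently_bounded (isCompact_Icc.isBounded)
    (hsq_mem.frequently)
  rw [closure_Icc] at hsstar_mem
  have hφt : Tendsto φ atTop atTop := hφ.tendsto_atTop
  have hsstar : sstar < 0 := by linarith [hsstar_mem.2]
  have hns : 0 < -sstar := neg_pos.2 hsstar
  set lamφ : ℕ → ℝ := fun j => lam (φ j) with hlamφdef
  have hlamφ : ∀ j, 0 < lamφ j := fun j => hlam (φ j)
  have hlam0φ : Tendsto lamφ atTop (𝓝 0) := hlam0.comp hφt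
  have hptφ : ∀ (j : ℕ) (s' : ℝ) (y' : EuclideanSpace ℝ (Fin 3)),
      ((lamφ j) • stPull ((lamφ j) ^ 2) (lamφ j) (0 : ℝ) (0 : (EuclideanSpace ℝ (Fin 3))) v') s' y' =
        ((R * (lamφ j / 2)) / ν) • u (T + (R * (lamφ j / 2)) ^ 2 * s' / ν) (x₀ + (R * (lamφ j / 2)) • y') :=
    fun j => hpt (φ j)
  have hL3φ : ∀ a : ℝ, 0 < a → Tendsto (fun j => eLpNorm
      (uncurry ((lamφ j) • stPull ((lamφ j) ^ 2) (lamφ j) (0 : ℝ) (0 : (EuclideanSpace ℝ (Fin 3))) v') - uncurry w) 3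
      (volume.restrict (parabolicCylinder a (0 : ℝ × (EuclideanSpace ℝ (Fin 3)))))) atTop (𝓝 0) :=
    fun a ha => (hL3 a ha).comp hφt
  set σ : ℝ := Real.sqrt (-sstar) with hσdef
  have hσ : 0 < σ := Real.sqrt_pos.2 hns
  have hσ2 : σ ^ 2 = -sstar := Real.sq_sqrt hns.le
  have hσne : σ ≠ 0 := hσ.ne'
  set lam' : ℕ → ℝ := fun j => σ * lamφ j with hlam'def
  have hlam' : ∀ j, 0 < lam' j := fun j => mul_pos hσ (hlamφ j)
  have hlam0' : Tendsto lam' atTop (𝓝 0) := by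
    show Tendsto (fun j => σ * lamφ j) atTop (𝓝 0)
    simpa using hlam0φ.const_mul σ
  set w' : ℝ → (EuclideanSpace ℝ (Fin 3)) → (EuclideanSpace ℝ (Fin 3)) :=
    σ • stPull (σ ^ 2) σ (0 : ℝ) (0 : (EuclideanSpace ℝ (Fin 3))) w with hw'def
  set v₁' : ℝ → (EuclideanSpace ℝ (Fin 3)) → (EuclideanSpace ℝ (Fin 3)) :=
    σ • stPull (σ ^ 2) σ (0 : ℝ) (0 : (EuclideanSpace ℝ (Fin 3))) v₁ with hv₁'def
  have hZZ : ∀ j, (lam' j) • stPull ((lam' j) ^ 2) (lam' j) (0 : ℝ) (0 : (EuclideanSpace ℝ (Fin 3))) v' =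
      σ • stPull (σ ^ 2) σ (0 : ℝ) (0 : (EuclideanSpace ℝ (Fin 3)))
        ((lamφ j) • stPull ((lamφ j) ^ 2) (lamφ j) (0 : ℝ) (0 : (EuclideanSpace ℝ (Fin 3))) v') := by
    intro j
    simp only [hlam'def]
    rw [zoom_zoom]
  have hpt' : ∀ (j : ℕ) (s' : ℝ) (y' : (EuclideanSpace ℝ (Fin 3))),
      ((lam' j) • stPull ((lam' j) ^ 2) (lam' j) (0 : ℝ) (0 : (EuclideanSpace ℝ (Fin 3))) v') s' y' =
        ((R * (lam' j / 2)) / ν) • u (T + (R * (lam' j / 2)) ^ 2 * s' / ν) (x₀ + (R * (lam' j / 2)) • y') := by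
    intro j s' y'
    have h := hptφ j (σ ^ 2 * s') (σ • y')
    simp only [smul_stPull_apply, zero_add] at h ⊢
    simp only [hlam'def]
    rw [show (σ * lamφ j) ^ 2 * s' = lamφ j ^ 2 * (σ ^ 2 * s') by ring,
      show (σ * lamφ j) • y' = lamφ j • σ • y' by rw [smul_smul, mul_comm],
      mul_smul, h, smul_smul, smul_smul,
      show σ * (R * (lamφ j / 2) / ν) = R * (σ * lamφ j / 2) / ν by ring,
      show T + (R * (lamφ j / 2)) ^ 2 * (σ ^ 2 * s') / ν = T + (R * (σ * lamφ j / 2)) ^ 2 * s' / ν by ring,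
      show R * (lamφ j / 2) * σ = R * (σ * lamφ j / 2) by ring]
  have hus : ∀ f g : ℝ → (EuclideanSpace ℝ (Fin 3)) → (EuclideanSpace ℝ (Fin 3)),
      uncurry (f - g) = uncurry f - uncurry g := fun f g => rfl
  have hL3' : ∀ a : ℝ, 0 < a → Tendsto (fun j => eLpNorm
      (uncurry ((lam' j) • stPull ((lam' j) ^ 2) (lam' j) (0 : ℝ) (0 : (EuclideanSpace ℝ (Fin 3))) v') - uncurry w') 3
      (volume.restrict (parabolicCylinder a (0 : ℝ × (EuclideanSpace ℝ (Fin 3)))))) atTop (𝓝 0) := by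
    intro a ha
    have hdiff : ∀ j, uncurry ((lam' j) • stPull ((lam' j) ^ 2) (lam' j) (0 : ℝ) (0 : (EuclideanSpace ℝ (Fin 3))) v') -
        uncurry w' = uncurry (σ • stPull (σ ^ 2) σ (0 : ℝ) (0 : (EuclideanSpace ℝ (Fin 3)))
          ((lamφ j) • stPull ((lamφ j) ^ 2) (lamφ j) (0 : ℝ) (0 : (EuclideanSpace ℝ (Fin 3))) v' - w)) := by
      intro j
      rw [hZZ j]
      funext z
      obtain ⟨s', y'⟩ := z
      simp only [hw'def, uncurry_apply_pair, Pi.sub_apply, smul_stPull_apply, smul_sub]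
    have hconst : (‖σ‖ₑ * (ENNReal.ofReal ((σ ^ 2 * σ ^ 3)⁻¹)) ^ (1 / (3 : ℝ≥0∞).toReal)) ≠ ⊤ :=
      ENNReal.mul_ne_top enorm_ne_top
        (ENNReal.rpow_ne_top_of_nonneg (one_div_nonneg.2 ENNReal.toReal_nonneg) ENNReal.ofReal_ne_top)
    have key := ENNReal.Tendsto.const_mul (hL3φ (a * σ) (mul_pos ha hσ)) (Or.inr hconst)
    rw [mul_zero] at key
    refine key.congr fun j => ?_
    rw [hdiff j]
    conv_rhs => rw [show a = a * σ / σ by field_simp]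
    rw [eLpNorm_uncurry_zoom hσ σ _ (a * σ) three_ne_zero ENNReal.ofNat_ne_top, hus]
  have hslab : stAffine (σ ^ 2) σ (0 : ℝ) (0 : (EuclideanSpace ℝ (Fin 3))) ⁻¹'
      (Iio (0 : ℝ) ×ˢ (univ : Set (EuclideanSpace ℝ (Fin 3)))) =
      Iio (0 : ℝ) ×ˢ (univ : Set (EuclideanSpace ℝ (Fin 3))) := by
    ext z
    simp only [mem_preimage, mem_prod, mem_Iio, mem_univ, and_true, stAffine_fst, zero_add]
    exact ⟨fun h => neg_of_mul_neg_right h (pow_pos hσ 2).le,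
      fun h => mul_neg_of_pos_of_neg (pow_pos hσ 2) h⟩
  have hae' : ∀ᵐ x ∂(volume.restrict (Iio (0 : ℝ) ×ˢ (univ : Set (EuclideanSpace ℝ (Fin 3))))),
      uncurry w' x = uncurry v₁' x := by
    have h := ae_eq_restrict_comp_stAffine (f := uncurry w) (g := uncurry v₁) (pow_pos hσ 2) hσ
      (0 : ℝ) (0 : (EuclideanSpace ℝ (Fin 3))) hae
    rw [hslab] at h
    filter_upwards [h] with z hz
    show σ • uncurry w (stAffine (σ ^ 2) σ (0 : ℝ) (0 : (EuclideanSpace ℝ (Fin 3))) z) =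
      σ • uncurry v₁ (stAffine (σ ^ 2) σ (0 : ℝ) (0 : (EuclideanSpace ℝ (Fin 3))) z)
    rw [show uncurry w (stAffine (σ ^ 2) σ (0 : ℝ) (0 : (EuclideanSpace ℝ (Fin 3))) z) =
      uncurry v₁ (stAffine (σ ^ 2) σ (0 : ℝ) (0 : (EuclideanSpace ℝ (Fin 3))) z) from hz]
  have hrate' : HasTypeITimeDecay C₁ v₁' := rate_smul_stPull hP.1 hσ
  have hcont' : ContinuousOn (uncurry v₁') (Iio (0 : ℝ) ×ˢ univ) := cont_smul_stPull hP.2.1 hσ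
  have hmild' := mild_smul_stPull hP.2.2.1 hσ
  set σ' : ℕ → ℝ := fun j => Real.sqrt (-sq (φ j)) / Real.sqrt ν with hσ'def
  set σinf : ℝ := Real.sqrt (-sstar) / Real.sqrt ν with hσinfdef
  have hσinf : 0 < σinf := div_pos (Real.sqrt_pos.2 hns) (Real.sqrt_pos.2 hν)
  have hσ'lim : Tendsto σ' atTop (𝓝 σinf) :=
    ((Real.continuous_sqrt.tendsto _).comp hsφ.neg).div_const _
  have hsseq : Tendsto (fun j => sq (φ j) / σ ^ 2) atTop (𝓝 (-1)) := by
    rw [hσ2]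
    have h := hsφ.div_const (-sstar)
    rw [show sstar / -sstar = (-1 : ℝ) by rw [div_neg, div_self hsstar.ne]] at h
    exact h
  have hsqneg : ∀ᶠ j in atTop, sq (φ j) < 0 :=
    (hφt.eventually hsq_mem).mono fun j hj => by linarith [hj.2]
  set W : ℕ → EuclideanSpace ℝ (Fin 3) → EuclideanSpace ℝ (Fin 3) := fun j y =>
    Real.sqrt (T - t (kk (φ j))) • u (t (kk (φ j))) (x₀ + Real.sqrt (T - t (kk (φ j))) • y) with hWdef
  set G : ℕ → EuclideanSpace ℝ (Fin 3) → (EuclideanSpace ℝ (Fin 3) →L[ℝ] EuclideanSpace ℝ (Fin 3)) := fun j y =>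
    Real.sqrt (T - t (kk (φ j))) ^ 2 • fderiv ℝ (u (t (kk (φ j)))) (x₀ + Real.sqrt (T - t (kk (φ j))) • y) with hGdef
  have hsqrt : ∀ j, sq (φ j) < 0 → Real.sqrt (T - t (kk (φ j))) = (R * (lamφ j / 2)) * σ' j := by
    intro j hj
    have hid : T - t (kk (φ j)) = (R * (lamφ j / 2)) ^ 2 * (-sq (φ j) / ν) := by
      rw [hsq_id (φ j)]
      simp only [hτdef, hlamφdef]
      field_simp
    rw [hid, hσ'def, Real.sqrt_mul (pow_nonneg (hΛ (φ j)).le 2), Real.sqrt_sq (hΛ (φ j)).le,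
      Real.sqrt_div' _ hν.le]
  have htime : ∀ j, t (kk (φ j)) = T + (R * (lamφ j / 2)) ^ 2 * sq (φ j) / ν := by
    intro j
    have h := hsq_id (φ j)
    simp only [hτdef, hlamφdef] at h ⊢
    have hν' : ν ≠ 0 := hν.ne'
    field_simp at h
    field_simp
    linarith
  have hW : ∀ j, sq (φ j) < 0 → ∀ y : EuclideanSpace ℝ (Fin 3), W j y =
      (σ' j * ν / σ) • ((lam' j) • stPull ((lam' j) ^ 2) (lam' j) (0 : ℝ) (0 : (EuclideanSpace ℝ (Fin 3))) v')
        (sq (φ j) / σ ^ 2) ((σ' j / σ) • y) := by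
    intro j hj y
    have e1 : σ' j * ν / σ * (R * (σ * lamφ j / 2) / ν) = R * (lamφ j / 2) * σ' j := by
      field_simp
    have e2 : T + (R * (σ * lamφ j / 2)) ^ 2 * (sq (φ j) / σ ^ 2) / ν = T + (R * (lamφ j / 2)) ^ 2 * sq (φ j) / ν := by
      field_simp
    have e3 : R * (σ * lamφ j / 2) * (σ' j / σ) = R * (lamφ j / 2) * σ' j := by
      field_simp
    rw [hpt' j]
    simp only [hWdef]
    rw [hsqrt j hj, htime j]
    simp only [hlam'def, smul_smul]
    rw [e1, e2, e3]
  have hG : ∀ j, sq (φ j) < 0 → ∀ y : EuclideanSpace ℝ (Fin 3), G j y =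
      (σ' j ^ 2 * ν / σ ^ 2) • fderiv ℝ (((lam' j) • stPull ((lam' j) ^ 2) (lam' j) (0 : ℝ)
        (0 : (EuclideanSpace ℝ (Fin 3))) v') (sq (φ j) / σ ^ 2)) ((σ' j / σ) • y) := by
    intro j hj y
    have hfun : ((lam' j) • stPull ((lam' j) ^ 2) (lam' j) (0 : ℝ) (0 : (EuclideanSpace ℝ (Fin 3))) v')
        (sq (φ j) / σ ^ 2) = (((R * (lam' j / 2)) / ν) • stPull ((R * (lam' j / 2)) ^ 2 / ν) (R * (lam' j / 2)) T x₀ u)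
          (sq (φ j) / σ ^ 2) := by
      funext y'
      rw [hpt' j, smul_stPull_apply]
      congr 2
      ring
    have e2 : T + (R * (σ * lamφ j / 2)) ^ 2 / ν * (sq (φ j) / σ ^ 2) = T + (R * (lamφ j / 2)) ^ 2 * sq (φ j) / ν := by
      field_simp
    have e3 : R * (σ * lamφ j / 2) * (σ' j / σ) = R * (lamφ j / 2) * σ' j := by
      field_simp
    have e4 : σ' j ^ 2 * ν / σ ^ 2 * (R * (σ * lamφ j / 2) / ν * (R * (σ * lamφ j / 2))) =
        (R * (lamφ j / 2) * σ' j) ^ 2 := by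
      field_simp
    rw [hfun, fderiv_smul_stPull]
    simp only [hGdef]
    rw [hsqrt j hj, htime j]
    simp only [hlam'def, smul_smul]
    rw [e2, e3, e4]
  -- ## diagonal convergence in the rescaled subsequence frame, at the base point `(σ∞/σ) y`
  have hdiag : ∀ y : EuclideanSpace ℝ (Fin 3),
      Tendsto (fun j => ((lam' j) • stPull ((lam' j) ^ 2) (lam' j) (0 : ℝ) (0 : (EuclideanSpace ℝ (Fin 3))) v')
        (sq (φ j) / σ ^ 2) ((σ' j / σ) • y)) atTop (𝓝 (v₁' (-1) ((σinf / σ) • y))) ∧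
      Tendsto (fun j => fderiv ℝ (((lam' j) • stPull ((lam' j) ^ 2) (lam' j) (0 : ℝ) (0 : (EuclideanSpace ℝ (Fin 3))) v')
        (sq (φ j) / σ ^ 2)) ((σ' j / σ) • y)) atTop (𝓝 (fderiv ℝ (v₁' (-1)) ((σinf / σ) • y))) := fun y =>
    localZoomFrame_diag hν hT hsol.smooth_velocity.continuousOn hρ hM hR hball1 hlam' hlam0' hr₁ hr₁1 hKs hpt'
      hL3' hae' hrate' hcont' hmild' ((σinf / σ) • y) hsseq ((hσ'lim.div_const σ).smul_const y)
  have hv₁'val : ∀ y : EuclideanSpace ℝ (Fin 3), v₁' (-1) ((σinf / σ) • y) = σ • v₁ sstar (σinf • y) := by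
    intro y
    simp only [hv₁'def, smul_stPull_apply, smul_smul, zero_add]
    rw [show σ ^ 2 * (-1) = sstar by rw [hσ2]; ring, show σ * (σinf / σ) = σinf by field_simp]
  have hDv₁'val : ∀ y : EuclideanSpace ℝ (Fin 3),
      fderiv ℝ (v₁' (-1)) ((σinf / σ) • y) = (σ * σ) • fderiv ℝ (v₁ sstar) (σinf • y) := by
    intro y
    simp only [hv₁'def]
    rw [fderiv_smul_stPull]
    simp only [smul_smul, zero_add]
    rw [show σ ^ 2 * (-1) = sstar by rw [hσ2]; ring, show σ * (σinf / σ) = σinf by field_simp]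
  have hconvW : ∀ y, Tendsto (fun j => W j y) atTop (𝓝 ((σinf * ν) • v₁ sstar (σinf • y))) := by
    intro y
    have h := ((hσ'lim.mul_const ν).div_const σ).smul (hdiag y).1
    rw [hv₁'val, smul_smul, show σinf * ν / σ * σ = σinf * ν by field_simp] at h
    refine h.congr' ?_
    filter_upwards [hsqneg] with j hj
    exact (hW j hj y).symm
  have hconvG : ∀ y, Tendsto (fun j => G j y) atTop (𝓝 ((σinf ^ 2 * ν) • fderiv ℝ (v₁ sstar) (σinf • y))) := by
    intro y
    have h := (((hσ'lim.pow 2).mul_const ν).div_const (σ ^ 2)).smul (hdiag y).2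
    rw [hDv₁'val, smul_smul, show σinf ^ 2 * ν / σ ^ 2 * (σ * σ) = σinf ^ 2 * ν by field_simp] at h
    refine h.congr' ?_
    filter_upwards [hsqneg] with j hj
    exact (hG j hj y).symm
  exact ⟨C₁, v₁, sstar, σinf, fun j => kk (φ j), hP, hsing₁, hsstar, hσinf, hkk.comp hφt, fun y =>
    ⟨hconvW y, hconvG y⟩⟩

end Summit.NavierStokesRegularity.NavierStokesRegularity.Theorems.LocalSineTubeDoorSequentialZoom

end
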